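import Summits.ResolutionOfSingularities.ResolutionOfSingularities.Theorems.WeightedInvariantLocalWeightedDropWildPurePowerFlagStepT
import Summits.ResolutionOfSingularities.ResolutionOfSingularities.Theorems.WeightedInvariantLocalWeightedDropWildPurePowerFlagLemmaTwo
import Literature.AlgebraicGeometry.Resolution.PointBlowupFlagKangarooCase

/-!
# `WeightedInvariant.LocalWeightedDrop`, line `hasse-ridge-face-selection`, piece S3πM: the weighted TRANSPORT of
# [HP24, Prop. 4] case (iv) on the game-side flag invariant (series) — `d_t`, the exponent dictionary, `n·ord H ≤ j`, the endgame

Crux item stmt-ResolutionOfSingularities-8899 `LocalWeightedDrop` (route `ResolutionOfSingularities/WeightedInvariant`), serving the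
door `WeightedConstruction` stmt-ResolutionOfSingularities-0571.  [OURS · L1 W4.3, chain w43, stub worker 2 (gen 3); game-side
counterpart of the atlas-model file `Literature/…/PointBlowupFlagKangarooCase` (p506677) of the same seat, whose pure arithmetic
(`apply_le_of_weight_le_of_degree_le`, `kangaroo_arith`) is imported, not restated.  Not a statement of any manuscript.  Printed
source: H. Hauser, S. Perlega, *Resolving surface singularities in positive characteristic*, Publ. RIMS **60** (2024), proof of
Prop. 4, case (iv), pp. 795–797.]

Along the axis successor `x^q·C = B₀(x, xy)` (for the translated successor, `B₀ = expansion q B (C t * X)` and `C = cleanSeries q T`,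
file `…FlagStepT`), a CHILD flag of the second orientation `V(x′ + g(y′))`, `ord g = n ≥ 2` (on stub-1's definitions: the datum
`(true, g)`, read on the letter swap `swap C`), is controlled by the weight-line polynomial `P♭` of `swap C` of `…FlagLemmaTwo`:

* `exists_dt_stepT` — `d_t` on series: `d_𝓕(y − tx) = j ≥ 1` for a least-degree monomial `x^{o−j} y^j` of `B₀`, and `d′_res ≤ j`
  (Figure 1), when `C` is not terminal up to a triangular change.
* the exponent dictionary `C ↔ B₀` (`le_and_coeff_eq_of_stepZero`, `toNat_wOrder_swap_add_le_of_stepZero`,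
  `exists_coeff_ne_zero_of_coeff_weightLinePoly_swap`) and **`n·ord H + l ≤ j`** (`exists_mul_ordH_add_le_of_stepZero`: "it is
  straightforward to verify that `ord G = n_𝓖 · ord H`" and "`l ≤ j`" [HP24 p. 796]), where `ord H = deg P♭ − tdeg P♭`.
* `dFlag_swap_lt` — the endgame `d_𝓖 < d` from [HP24, LEMMA 2] (`dcurv_le_ordH`, `dcurv_lt_of_ordH_lt`) and `kangaroo_arith`, for
  any `d ≥ max(1, n·ord H)`.

Consumer: `…FlagKangaroo` (the case-(iv) clauses of stub-1's `DropKangarooStatement` / `DropZeroStatement`).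
-/

set_option linter.dupNamespace false -- mandated namespace of this single-conjunct summit

namespace Summit.ResolutionOfSingularities.ResolutionOfSingularities.Theorems

open Literature.AlgebraicGeometry.Resolution
open Literature.AlgebraicGeometry.Resolution.HauserPerlega2024

namespace PurePowerFlag

open MvPowerSeries

variable {k : Type} [Field k]

/-! ### Small bookkeeping -/

/-- `swapE {0} = {1}`: the new exceptional letter read on the letter swap. -/
theorem swapE_singleton_zero : swapE ({0} : Finset (Fin 2)) = {1} := by decide

/-- `swapE {0, 1} = {0, 1}`. -/
theorem swapE_pair : swapE ({0, 1} : Finset (Fin 2)) = {0, 1} := by decide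

/-- A tangent flag of tangency `≥ 2` read on the swap: `g ≠ 0`, `ord g = tangency g ≥ 2`. -/
theorem tangency_spec_of_two_le {g : PowerSeries k} (hg : g ≠ 0) (h2 : (2 : ℕ∞) ≤ g.order) :
    g.order = ((tangency g : ℕ) : ℕ∞) ∧ 2 ≤ tangency g := by
  have hfin : g.order ≠ ⊤ := fun h => hg (PowerSeries.order_eq_top.mp h)
  have hord : g.order = ((tangency g : ℕ) : ℕ∞) := by unfold tangency; exact (ENat.coe_toNat hfin).symm
  refine ⟨hord, ?_⟩
  rw [hord] at h2
  exact_mod_cast h2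

open Classical in
/-- With `q = 1` every series is deleted by the cleaning: the statements are vacuous for `e = 0`. -/
theorem cleanSeries_one (B : MvPowerSeries (Fin 2) k) : cleanSeries 1 B = 0 := by
  ext d
  rw [coeff_cleanSeries, if_pos (fun i => one_dvd _), map_zero]

/-- The letter swap on the exponent `x^a y^b`. -/
theorem equivMapDomain_swap_single_add_single (a b : ℕ) :
    Finsupp.equivMapDomain (Equiv.swap (0 : Fin 2) 1) (Finsupp.single 0 a + Finsupp.single 1 b) =
      Finsupp.single 0 b + Finsupp.single 1 a := by
  ext i
  rw [Finsupp.equivMapDomain_apply, Equiv.symm_swap]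
  rcases fin_two_cases i with rfl | rfl
  · rw [Equiv.swap_apply_left, Finsupp.add_apply, Finsupp.add_apply, Finsupp.single_eq_same, Finsupp.single_eq_same,
      Finsupp.single_eq_of_ne (by decide : (1 : Fin 2) ≠ 0), Finsupp.single_eq_of_ne (by decide : (0 : Fin 2) ≠ 1),
      zero_add, add_zero]
  · rw [Equiv.swap_apply_right, Finsupp.add_apply, Finsupp.add_apply, Finsupp.single_eq_same, Finsupp.single_eq_same,
      Finsupp.single_eq_of_ne (by decide : (0 : Fin 2) ≠ 1), Finsupp.single_eq_of_ne (by decide : (1 : Fin 2) ≠ 0),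
      zero_add, add_zero]

/-- `[x^a y^b](swap C) = [x^b y^a] C`. -/
theorem coeff_swap_single_add_single (C : MvPowerSeries (Fin 2) k) (a b : ℕ) :
    coeff (Finsupp.single 0 a + Finsupp.single 1 b) (swap C) = coeff (Finsupp.single 0 b + Finsupp.single 1 a) C := by
  rw [coeff_swap, equivMapDomain_swap_single_add_single]

/-! ### `d_t` on series ([HP24 §4 p. 779]: "`d_t = ord_{(y)} F^{(d)}_t(x, y)`") -/

/-- **`d_t`**: along the translated successor `x^q·T = B(x, x(t+y))` with `C = cleanSeries q T ≠ 0` not terminal up to a triangular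
change, the parent flag `y − t·x` (datum `C t * X`, `n = 1`) has `d_𝓕 = j ≥ 1`, where `x^{o−j} y^j` is a least-degree monomial of
`B₀ = expansion q B (C t * X)` of least `y`-exponent, and `d′_res = dRes C {0} ≤ j` (Figure 1).  The clause `d_𝓕 = 0` and `j = 0`
are excluded because they would put `C` in the small residual resp. monomial case. [HP24 §4 pp. 779–780, Prop. 4 (ii) p. 795] -/
theorem exists_dt_stepT (q : ℕ) {B T : MvPowerSeries (Fin 2) k} (hq : ((q : ℕ) : ℕ∞) < B.order) {t : k}
    (hT : (X 0 : MvPowerSeries (Fin 2) k) ^ q * T = subst (PlaneGerm.dirChart t) B)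
    (hC0 : cleanSeries q T ≠ 0) (hnt : ¬ TermSub q (cleanSeries q T)) :
    ∃ d₀ : Fin 2 →₀ ℕ, coeff d₀ (expansion q B (PowerSeries.C t * PowerSeries.X)) ≠ 0 ∧
      d₀ 0 + d₀ 1 = (expansion q B (PowerSeries.C t * PowerSeries.X)).order.toNat ∧
      dFlag q B (PowerSeries.C t * PowerSeries.X) 1 = d₀ 1 ∧ 0 < d₀ 1 ∧ dRes (cleanSeries q T) {0} ≤ d₀ 1 := by
  classical
  set C := cleanSeries q T with hCdef
  set hpar : PowerSeries k := PowerSeries.C t * PowerSeries.X with hpar_def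
  set B₀ := expansion q B hpar with hB₀
  have hpar0 : PowerSeries.constantCoeff hpar = 0 := by
    rw [hpar_def, map_mul, PowerSeries.constantCoeff_X, mul_zero]
  have hstep : (X 0 : MvPowerSeries (Fin 2) k) ^ q * C = subst (PlaneGerm.dirChart (0 : k)) B₀ :=
    X_pow_mul_clean_eq_stepZero_expansion q t hT
  have hqB₀ : ((q : ℕ) : ℕ∞) < B₀.order := lt_order_expansion q hq hpar hpar0
  have hCclean : cleanSeries q C = C := cleanSeries_cleanSeries q T
  have hB₀ne : B₀ ≠ 0 := expansion_ne_zero_of_clean_ne_zero q t hT hC0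
  have hin0 : initialPart (weights 1) B₀ ≠ 0 := by
    obtain ⟨d₁, hd₁, hd₁deg⟩ := exists_coeff_ne_zero_degree_eq_order hB₀ne
    intro h0
    have : coeff d₁ (initialPart (weights 1) B₀) ≠ 0 := by
      rw [coeff_initialPart_ne_zero_iff]
      refine ⟨hd₁, ?_⟩
      rw [weights_one_eq, wOrder_eq, ← Finsupp.degree_eq_weight_one]
      change ((d₁.degree : ℕ) : ℕ∞) = B₀.order
      rw [Finsupp.degree_eq_sum, Fin.sum_univ_two, hd₁deg]
      exact (MvPowerSeries.ne_zero_iff_order_finite.mp hB₀ne)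
    rw [h0, map_zero] at this
    exact this rfl
  obtain ⟨d₀, hd₀in, hd₀y⟩ := exists_coeff_ne_zero_ordAlong (1 : Fin 2) hin0
  obtain ⟨hd₀, hd₀w⟩ := (coeff_initialPart_ne_zero_iff _ _ _).mp hd₀in
  have hd₀deg : d₀ 0 + d₀ 1 = B₀.order.toNat := by
    rw [weights_one_eq, wOrder_eq, ← Finsupp.degree_eq_weight_one] at hd₀w
    change ((d₀.degree : ℕ) : ℕ∞) = B₀.order at hd₀w
    rw [← (MvPowerSeries.ne_zero_iff_order_finite.mp hB₀ne)] at hd₀w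
    have h3 : d₀.degree = B₀.order.toNat := by exact_mod_cast hd₀w
    rw [Finsupp.degree_eq_sum, Fin.sum_univ_two] at h3
    exact h3
  have hdcurv : dcurv q B hpar 1 = ((d₀ 1 : ℕ) : ℕ∞) := by
    show ordAlong (1 : Fin 2) (initialPart (weights 1) B₀) = _
    rw [hd₀y]
  have hres : dRes C {0} ≤ d₀ 1 := dRes_singleton_zero_le_of_stepZero q hB₀ne hqB₀.le hstep hd₀ hd₀deg
  have hwFlag : (wFlag q B hpar 1).toNat = B₀.order.toNat := by
    show (wOrder (weights 1) B₀).toNat = _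
    rw [weights_one_eq, wOrder_eq]; rfl
  have hnotClause : ¬ (0 < d₀ 1 ∧ d₀ 1 < q ∧ q ∣ B₀.order.toNat) := by
    rintro ⟨-, hlt, hdvd⟩
    apply hnt
    rcases Nat.eq_zero_or_pos (dRes C {0}) with h0 | hpos
    · exact termSub_of_dRes_eq_zero {0} hC0 hCclean h0
    · obtain ⟨j, hj⟩ := hdvd
      have hqo : q < B₀.order.toNat := by
        have hfin := MvPowerSeries.ne_zero_iff_order_finite.mp hB₀ne
        rw [← hfin] at hqB₀; exact_mod_cast hqB₀
      have hj2 : 2 ≤ j := by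
        by_contra hj1
        interval_cases j <;> simp_all
      refine termSub_of_dRes_lt hC0 hCclean (m := j - 1) (by omega) ?_ hpos (lt_of_le_of_lt hres hlt)
      rw [ordAlong_zero_stepZero q hB₀ne hqB₀.le hstep, hj, Nat.mul_sub, mul_one]
  have hdFlag : dFlag q B hpar 1 = d₀ 1 := by
    unfold dFlag
    rw [hdcurv, ENat.toNat_coe, hwFlag, if_neg hnotClause]
  have hpos : 0 < d₀ 1 := by
    by_contra h0
    exact hnt (termSub_of_dRes_eq_zero {0} hC0 hCclean (by omega))
  exact ⟨d₀, hd₀, hd₀deg, hdFlag, hpos, hres⟩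

/-! ### The exponent dictionary of the axis successor `x^q·C = B₀(x, xy)` -/

/-- From `C` to `B₀`: a monomial `x^A y^i` of `C` is the monomial `x^{A+q−i} y^i` of `B₀` (and `i ≤ A + q`). -/
theorem le_and_coeff_eq_of_stepZero (q : ℕ) {B₀ C : MvPowerSeries (Fin 2) k}
    (hC : (X 0 : MvPowerSeries (Fin 2) k) ^ q * C = subst (PlaneGerm.dirChart (0 : k)) B₀) {m : Fin 2 →₀ ℕ}
    (hm : coeff m C ≠ 0) :
    m 1 ≤ m 0 + q ∧ coeff m C = coeff (Finsupp.single 0 (m 0 + q - m 1) + Finsupp.single 1 (m 1)) B₀ := by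
  have hC' := hC
  rw [subst_dirChart_zero_eq] at hC'
  have h := coeff_eq_of_step q 0 1 zero_ne_one_fin fin_two_cases B₀ C hC' m
  by_cases hle : m 1 ≤ m 0 + q
  · rw [if_pos hle] at h; exact ⟨hle, h⟩
  · rw [if_neg hle] at h; exact absurd h hm

/-- From `B₀` to `C`: a monomial `x^a y^i` of `B₀` has `q ≤ a + i` and is the monomial `x^{a+i−q} y^i` of `C`. -/
theorem le_and_coeff_eq_of_stepZero' (q : ℕ) {B₀ C : MvPowerSeries (Fin 2) k}
    (hC : (X 0 : MvPowerSeries (Fin 2) k) ^ q * C = subst (PlaneGerm.dirChart (0 : k)) B₀) {d : Fin 2 →₀ ℕ}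
    (hd : coeff d B₀ ≠ 0) :
    q ≤ d 0 + d 1 ∧ coeff (Finsupp.single 0 (d 0 + d 1 - q) + Finsupp.single 1 (d 1)) C = coeff d B₀ := by
  have hC' := hC
  rw [subst_dirChart_zero_eq] at hC'
  exact coeff_eq_of_step' q 0 1 zero_ne_one_fin fin_two_cases B₀ C hC' d hd

/-- **`ω̃ ≥ ord_ω + n·q`** ([HP24 p. 796]: the weights `ω̃(x) = n`, `ω̃(y) = n + 1` upstairs against `ω` on the successor read on the
swap, `ω(x′) = n`, `ω(y′) = 1`): every monomial `x^a y^i` of `B₀` has `n·a + (n+1)·i ≥ ord_ω(swap C) + n·q`. -/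
theorem toNat_wOrder_swap_add_le_of_stepZero (q n : ℕ) {B₀ C : MvPowerSeries (Fin 2) k}
    (hC : (X 0 : MvPowerSeries (Fin 2) k) ^ q * C = subst (PlaneGerm.dirChart (0 : k)) B₀) {d : Fin 2 →₀ ℕ}
    (hd : coeff d B₀ ≠ 0) :
    (wOrder (weights n) (swap C)).toNat + n * q ≤ n * d 0 + (n + 1) * d 1 := by
  obtain ⟨hq, hcoef⟩ := le_and_coeff_eq_of_stepZero' q hC hd
  have hne : coeff (Finsupp.single 0 (d 1) + Finsupp.single 1 (d 0 + d 1 - q)) (swap C) ≠ 0 := by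
    rw [coeff_swap_single_add_single, hcoef]; exact hd
  have h := toNat_wOrder_le (n := n) hne
  rw [Finsupp.add_apply, Finsupp.add_apply, Finsupp.single_eq_same, Finsupp.single_eq_same,
    Finsupp.single_eq_of_ne (by decide : (0 : Fin 2) ≠ 1), Finsupp.single_eq_of_ne (by decide : (1 : Fin 2) ≠ 0),
    add_zero, zero_add] at h
  have h2 : n * (d 0 + d 1 - q) + n * q = n * (d 0 + d 1) := by rw [← Nat.mul_add, Nat.sub_add_cancel hq]
  calc (wOrder (weights n) (swap C)).toNat + n * q ≤ d 1 + n * (d 0 + d 1 - q) + n * q := by omega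
    _ = d 1 + n * (d 0 + d 1) := by rw [add_assoc, h2]
    _ = n * d 0 + (n + 1) * d 1 := by ring

/-- A non-zero coefficient `b` of the weight-line polynomial `P♭` of `swap C` (weights `ω(y) = n`) is a least-`ω̃`-weight monomial of
`B₀` with `y`-exponent `ord_ω − n·b`. [HP24 p. 796: "in_ω̃(F₀) = x^e y^f·G", "in_ω(F′₀) = x^a y^b·H"] -/
theorem exists_coeff_ne_zero_of_coeff_weightLinePoly_swap (q n : ℕ) {B₀ C : MvPowerSeries (Fin 2) k}
    (hC : (X 0 : MvPowerSeries (Fin 2) k) ^ q * C = subst (PlaneGerm.dirChart (0 : k)) B₀) {b : ℕ}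
    (hb : (∑ b ∈ Finset.range ((wOrder (weights n) (swap C)).toNat / n + 1), Polynomial.monomial b
        (coeff (Finsupp.single 0 ((wOrder (weights n) (swap C)).toNat - n * b) + Finsupp.single 1 b) (swap C))).coeff b ≠ 0) :
    n * b ≤ (wOrder (weights n) (swap C)).toNat ∧
      ∃ d : Fin 2 →₀ ℕ, coeff d B₀ ≠ 0 ∧ d 1 = (wOrder (weights n) (swap C)).toNat - n * b ∧
        n * d 0 + (n + 1) * d 1 = (wOrder (weights n) (swap C)).toNat + n * q := by
  set W := (wOrder (weights n) (swap C)).toNat with hW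
  obtain ⟨hnb, hc⟩ := mul_le_and_coeff_ne_zero_of_coeff_weightLinePoly hb
  rw [coeff_swap_single_add_single] at hc
  obtain ⟨hle, hcoef⟩ := le_and_coeff_eq_of_stepZero q hC hc
  rw [Finsupp.add_apply, Finsupp.add_apply, Finsupp.single_eq_same, Finsupp.single_eq_same,
    Finsupp.single_eq_of_ne (by decide : (0 : Fin 2) ≠ 1), Finsupp.single_eq_of_ne (by decide : (1 : Fin 2) ≠ 0),
    add_zero, zero_add] at hle hcoef
  refine ⟨hnb, Finsupp.single 0 (b + q - (W - n * b)) + Finsupp.single 1 (W - n * b), ?_, ?_, ?_⟩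
  · rw [← hcoef]; exact hc
  · rw [Finsupp.add_apply, Finsupp.single_eq_same, Finsupp.single_eq_of_ne (by decide : (1 : Fin 2) ≠ 0), zero_add]
  · rw [Finsupp.add_apply, Finsupp.add_apply, Finsupp.single_eq_same, Finsupp.single_eq_same,
      Finsupp.single_eq_of_ne (by decide : (0 : Fin 2) ≠ 1), Finsupp.single_eq_of_ne (by decide : (1 : Fin 2) ≠ 0),
      add_zero, zero_add]
    zify [hnb, hle]
    ring

/-- **`n · ord H + l = l′ ≤ j`** ([HP24 p. 796]: "`ord G = n_𝓖 · ord H`" and "`l ≤ j`"): with `ord H = deg P♭ − tdeg P♭` for the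
weight-line polynomial `P♭` of `swap C`, there is a monomial `x^k y^l` of `B₀` (the least-`ω̃`-weight monomial of LEAST `y`-exponent)
such that `n·ord H + l ≤ j` for EVERY least-degree monomial `x^i y^j` of `B₀`. -/
theorem exists_mul_ordH_add_le_of_stepZero (q : ℕ) {n : ℕ} (hn : 0 < n) {B₀ C : MvPowerSeries (Fin 2) k} (hC0 : C ≠ 0)
    (hC : (X 0 : MvPowerSeries (Fin 2) k) ^ q * C = subst (PlaneGerm.dirChart (0 : k)) B₀) :
    ∃ dhi : Fin 2 →₀ ℕ, coeff dhi B₀ ≠ 0 ∧ ∀ d₁ : Fin 2 →₀ ℕ, coeff d₁ B₀ ≠ 0 → d₁ 0 + d₁ 1 = B₀.order.toNat →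
      n * ((∑ b ∈ Finset.range ((wOrder (weights n) (swap C)).toNat / n + 1), Polynomial.monomial b
            (coeff (Finsupp.single 0 ((wOrder (weights n) (swap C)).toNat - n * b) + Finsupp.single 1 b) (swap C))).natDegree -
          (∑ b ∈ Finset.range ((wOrder (weights n) (swap C)).toNat / n + 1), Polynomial.monomial b
            (coeff (Finsupp.single 0 ((wOrder (weights n) (swap C)).toNat - n * b) + Finsupp.single 1 b) (swap C))).natTrailingDegree) +
        dhi 1 ≤ d₁ 1 := by
  set W := (wOrder (weights n) (swap C)).toNat with hW
  set P := ∑ b ∈ Finset.range (W / n + 1), Polynomial.monomial b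
        (coeff (Finsupp.single 0 (W - n * b) + Finsupp.single 1 b) (swap C)) with hP
  have hP0 : P ≠ 0 := weightLinePoly_ne_zero hn (swap_ne_zero hC0)
  obtain ⟨hnlo, dlo, hdlo, hdlo1, hwlo⟩ := exists_coeff_ne_zero_of_coeff_weightLinePoly_swap q n hC
    (b := P.natTrailingDegree) (Polynomial.trailingCoeff_nonzero_iff_nonzero.mpr hP0)
  obtain ⟨hnhi, dhi, hdhi, hdhi1, -⟩ := exists_coeff_ne_zero_of_coeff_weightLinePoly_swap q n hC
    (b := P.natDegree) (by rw [Polynomial.coeff_natDegree]; exact Polynomial.leadingCoeff_ne_zero.mpr hP0)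
  rw [← hW] at hnlo hdlo1 hwlo hnhi hdhi1
  refine ⟨dhi, hdhi, fun d₁ hd₁ hd₁deg => ?_⟩
  have hw : n * dlo 0 + (n + 1) * dlo 1 ≤ n * d₁ 0 + (n + 1) * d₁ 1 := by
    rw [hwlo]; exact toNat_wOrder_swap_add_le_of_stepZero q n hC hd₁
  have hdeg : d₁ 0 + d₁ 1 ≤ dlo 0 + dlo 1 := by rw [hd₁deg]; exact order_toNat_le_degree hdlo
  have h1 : dlo 1 ≤ d₁ 1 := apply_le_of_weight_le_of_degree_le (x := (0 : Fin 2)) (y := (1 : Fin 2)) n hw hdeg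
  have h5 : P.natTrailingDegree ≤ P.natDegree := Polynomial.natTrailingDegree_le_natDegree P
  rw [hdlo1] at h1
  rw [hdhi1]
  have h6 : n * (P.natDegree - P.natTrailingDegree) + (W - n * P.natDegree) = W - n * P.natTrailingDegree := by
    zify [h5, hnhi, hnlo]
    ring
  omega

/-! ### The endgame of case (iv) on series -/

/-- **The endgame** ([HP24 p. 797]): for the cleaned successor `C ≠ 0` (`q = pᵉ`, `e ≥ 1`) and a flag `g` of tangency `n ≥ 2` read on
the swap, `d_𝓖 = dFlag q (swap C) g n < d` for every `d ≥ 1` with `n·ord H ≤ d` — by [HP24, LEMMA 2] at `a′`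
(`d^curv_𝓖 ≤ ord H + ε`, third assertion) and `kangaroo_arith`. -/
theorem dFlag_swap_lt (p : ℕ) [hp : Fact p.Prime] [CharP k p] {e : ℕ} (he : 1 ≤ e) {C : MvPowerSeries (Fin 2) k}
    (hC0 : C ≠ 0) (hCclean : cleanSeries (p ^ e) C = C) {g : PowerSeries k} {n : ℕ} (hordg : g.order = n) (hn : 2 ≤ n)
    {d : ℕ} (hd1 : 1 ≤ d)
    (hd : n * ((∑ b ∈ Finset.range ((wOrder (weights n) (swap C)).toNat / n + 1), Polynomial.monomial b
            (coeff (Finsupp.single 0 ((wOrder (weights n) (swap C)).toNat - n * b) + Finsupp.single 1 b) (swap C))).natDegree -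
          (∑ b ∈ Finset.range ((wOrder (weights n) (swap C)).toNat / n + 1), Polynomial.monomial b
            (coeff (Finsupp.single 0 ((wOrder (weights n) (swap C)).toNat - n * b) + Finsupp.single 1 b) (swap C))).natTrailingDegree)
        ≤ d) :
    dFlag (p ^ e) (swap C) g n < d := by
  have hP1 : 1 ≤ p ^ (e - 1) := Nat.one_le_pow _ _ hp.out.pos
  have hq2 : 2 * p ^ (e - 1) ≤ p ^ e := by
    have hpe : p ^ e = p ^ (e - 1) * p := by rw [← pow_succ]; congr 1; omega
    rw [hpe, mul_comm]
    exact Nat.mul_le_mul_left _ hp.out.two_le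
  have hswclean : cleanSeries (p ^ e) (swap C) = swap C := by rw [cleanSeries_swap, hCclean]
  have hsw0 : swap C ≠ 0 := swap_ne_zero hC0
  have hn0 : 0 < n := by omega
  obtain ⟨hwo, hcurv⟩ := dcurv_le_ordH p hn0 hsw0 hswclean hordg (e := e)
  set W := (wOrder (weights n) (swap C)).toNat with hW
  set P := ∑ b ∈ Finset.range (W / n + 1), Polynomial.monomial b
        (coeff (Finsupp.single 0 (W - n * b) + Finsupp.single 1 b) (swap C)) with hP
  set ordH := P.natDegree - P.natTrailingDegree with hordH
  have hdG : dFlag (p ^ e) (swap C) g n = if 0 < (dcurv (p ^ e) (swap C) g n).toNat ∧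
      (dcurv (p ^ e) (swap C) g n).toNat < p ^ e ∧ p ^ e ∣ W then 0 else (dcurv (p ^ e) (swap C) g n).toNat := by
    unfold dFlag; rw [hwo, ENat.toNat_coe]
  have hdc : (dcurv (p ^ e) (swap C) g n).toNat ≤ ordH + if p ^ e ∣ W then p ^ (e - 1) else 0 := by
    have := ENat.toNat_le_of_le_coe hcurv
    split_ifs at this ⊢ with hdv <;> omega
  have hthird : ordH = p ^ e - p ^ (e - 1) → (dcurv (p ^ e) (swap C) g n).toNat < p ^ e := by
    intro h3
    have hlt := dcurv_lt_of_ordH_lt p hn0 hsw0 hswclean hordg (e := e) (by rw [← hW, ← hP, ← hordH]; omega)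
    have hfin : dcurv (p ^ e) (swap C) g n ≠ ⊤ := ne_top_of_lt hlt
    rw [← ENat.coe_toNat hfin] at hlt
    exact_mod_cast hlt
  have h2n : 2 * ordH ≤ n * ordH := Nat.mul_le_mul_right _ hn
  exact kangaroo_arith hq2 hP1 hdG hdc (by omega) hd1 hthird

end PurePowerFlag

end Summit.ResolutionOfSingularities.ResolutionOfSingularities.Theorems
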